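import Summits.QuantumFields.BalabanUV.T4Continuum.Support.RegionInteriorW2
import Summits.QuantumFields.BalabanUV.T4Continuum.Support.DirichletStarVectorTowerTop

/-!
# T⁴ programme, spine node NE2 (U1a), sub-row Δ1 «NE2⁰-Dirichlet» — THE RENORMALISED STAR TOWER AT `S = ⊤`: every displayed input of
# `RegionInteriorW2.towerLimitRate_star_renorm_box_of_slice` is a THEOREM on the whole torus — the defect-free star tower of `Δ_a` converges
# at the torus rate `L⁻¹` with NO binder (non-vacuity certificate of the renormalised route)

NE2 formalisation swarm `b2b-balaban-t4-ne2-formalise-*`, LEAF PROVER 07 (gen 7), supplier item «Δ1-VEC-INTERIOR-W2-BOX», ⊤-witness (the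
analogue, for the owner's renormalised pairing `J̃` of p228571/p228905, of gen 6's `DirichletStarVectorTowerTop` for King's compressed pairing):

 * `nch_top` — at `⊤` every coarse star bond has exactly `L^d` star children (`DirichletStarSiblingClasses.card_cube` with `mult = 1`);
 * **`JnR_top_eq`** — at `⊤` the renormalised injection IS King's compressed pairing `JpR` (`(√(L^d))⁻¹·[parT y = i]`);
 * `isCoordBox_top` — the whole torus is a product region;
 * **`towerLimitRate_star_renorm_top (hL : 2 ≤ L) (ha : 0 < a) (ha′ : 0 < a′)`** — `RegionInteriorW2.towerLimitRate_star_renorm_box_of_slice`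
   BY NAME with W1 := gen 6's `RegionGaugeSliceTorus.sliceCoercive_top` (one constant `γ_D` for all levels) and W3̃ := gen 6's
   `DirichletStarVectorTowerTop.injected_star_top` (through `JnR_top_eq`): the renormalised star tower of `Δ_a` on the torus converges at the
   rate `L⁻¹` with constant `Cpert 0 √(CgIbox d a′ γ_D/2·γ⋆⁻¹) CJ 0 0 0`, `γ⋆ = gamStar d a′ γ_D` — NO displayed binder remains.

HONEST FRAMING (T4-DAG p. 1).  A consistency / non-vacuity witness at `S = ⊤` (model level, `U = 1`, finite torus); it says nothing about
`S ≠ ⊤`, where W1 (`SliceCoercive` uniformly in the region, G-ne2leaf07g5-1) and W3̃ remain OPEN; NE2 (U1a) NOT proved; spine 0/9 unchanged;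
NOT [B9] (3.16)/(3.23)–(3.27) as printed; NOT infinite volume, NOT a mass gap, NOT the Clay problem, NOT summit progress.  HONEST DEPENDENCY:
continuum YM on T⁴ ⇐ BetaPertH ∧ nine spine estimates (0/9 proved); BetaPertH ⇐ (D1) ∧ (D4) ∧ CAP+tail; G-an2-4 gates asym, D1 and
NE2/3/4.  No `sorry`.
-/

noncomputable section

open scoped BigOperators ComplexConjugate Matrix Matrix.Norms.L2Operator
open Finset

namespace Summit.QuantumFields.BalabanUV.T4Continuum.RegionInteriorW2Top

open Literature.MathematicalPhysics.QuantumFieldTheory.Balaban1983to89.B5Prop11Plancherel (Tor fine)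
open Literature.MathematicalPhysics.QuantumFieldTheory.Balaban1983to89.B5G183RateUnitTower (lev)
open Summit.QuantumFields.BalabanUV.T4Continuum
open Summit.QuantumFields.BalabanUV.T4Continuum.CovariantAveragingTower (TowerLimitRate)
open Summit.QuantumFields.BalabanUV.T4Continuum.BackgroundResolventTower (Cpert)
open Summit.QuantumFields.BalabanUV.T4Continuum.BalabanAveragedTowerUnit (one_le_lev')
open Summit.QuantumFields.BalabanUV.T4Continuum.BlockPairingGeometry (parT JK_apply)
open Summit.QuantumFields.BalabanUV.T4Continuum.KingPairingPlantedLaw (CJ JpcT_eq_JK)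
open Summit.QuantumFields.BalabanUV.T4Continuum.RegionGaugeFixedVector (starReg regionDeltaA)
open Summit.QuantumFields.BalabanUV.T4Continuum.RegionGaugeSliceTorus (blockReg_topU sliceCoercive_top)
open Summit.QuantumFields.BalabanUV.T4Continuum.DirichletRegionTower (gamD gamD_pos)
open Summit.QuantumFields.BalabanUV.T4Continuum.DirichletSubregionTowerOf (pidx JpR)
open Summit.QuantumFields.BalabanUV.T4Continuum.DirichletSubregionRenormTower (nch JnR AnR)
open Summit.QuantumFields.BalabanUV.T4Continuum.DirichletStarVectorTower (starP gamStar)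
open Summit.QuantumFields.BalabanUV.T4Continuum.DirichletStarVectorTowerTop (injected_star_top)
open Summit.QuantumFields.BalabanUV.T4Continuum.DirichletStarSiblingClasses (mult card_cube)
open Summit.QuantumFields.BalabanUV.T4Continuum.RegionInteriorW2 (CgIbox towerLimitRate_star_renorm_box_of_slice)
open Summit.QuantumFields.BalabanUV.Beta.GAN24.DirichletBoxTrace (blockReg)
open Summit.QuantumFields.BalabanUV.Beta.GAN24.DirichletBoxTwoLevel (IsCoordBox)

variable {d : ℕ} (L : ℕ) [NeZero L] (M : Fin d → ℕ) [hM : ∀ μ, NeZero (M μ)]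

/-- at `⊤` every coarse bond has exactly `L^d` star children. [folklore] -/
theorem nch_top (k : ℕ) (i : pidx L M (starP L M (fun _ : Tor M => True)) k) :
    nch L M (starP L M (fun _ : Tor M => True)) k i.1 = L ^ d := by
  have h := card_cube L M (fun _ : Tor M => True) k i
  rw [mult, if_pos (blockReg_topU (lev L k) M i.1.1), one_mul, Fintype.card_fun, Fintype.card_fin, Fintype.card_fin] at h
  exact h.symm

/-- **AT `⊤` THE RENORMALISED INJECTION IS KING's COMPRESSED PAIRING**: `J̃ = J_R` (both `(√(L^d))⁻¹·[parT y = i]`). [folklore] -/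
theorem JnR_top_eq (k : ℕ) :
    JnR L M (starP L M (fun _ : Tor M => True)) k = JpR L M (starP L M (fun _ : Tor M => True)) k := by
  have hx : (0 : ℝ) < (L : ℝ) ^ d := pow_pos (by exact_mod_cast Nat.pos_of_ne_zero (NeZero.ne L)) d
  ext y i
  simp only [JnR, JpR, Matrix.toBlock_apply, JpcT_eq_JK, JK_apply, nch_top]
  split_ifs with h
  · rw [mul_one, Nat.cast_pow]
    have key : (Real.sqrt ((L : ℝ) ^ d))⁻¹ = Real.sqrt ((L : ℝ) ^ d) * ((L : ℝ) ^ d)⁻¹ := by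
      rw [← div_eq_mul_inv, Real.sqrt_div_self', one_div]
    rw [key]
    push_cast
    ring
  · rw [mul_zero, mul_zero]

/-- the whole torus is a product region. [folklore] -/
theorem isCoordBox_top : IsCoordBox M (fun _ : Tor M => True) :=
  ⟨fun _ => Finset.univ, fun b => by simp⟩

variable (a a' : ℝ)

/-- **THE RENORMALISED STAR TOWER OF THE WHOLE TORUS CONVERGES AT THE RATE `L⁻¹` WITH NO DISPLAYED BINDER** (`L ≥ 2`, `0 < a`, `0 < a′`):
`RegionInteriorW2.towerLimitRate_star_renorm_box_of_slice` with W1 := `sliceCoercive_top`, W3̃ := `injected_star_top` ∘ `JnR_top_eq`. [folklore] -/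
theorem towerLimitRate_star_renorm_top (hL : 2 ≤ L) (ha : 0 < a) (ha' : 0 < a') :
    TowerLimitRate (AnR L M (starP L M (fun _ : Tor M => True))) ((L : ℝ) ^ d)
      (fun k => (regionDeltaA (lev L k) M a a' (fun _ : Tor M => True))⁻¹)
      (Cpert 0 (Real.sqrt (CgIbox d a' (gamD d a) / 2 * (gamStar d a' (gamD d a))⁻¹)) (CJ d a) 0 0 0) ((L : ℝ)⁻¹) :=
  towerLimitRate_star_renorm_box_of_slice L M (fun _ : Tor M => True) a a' hL (isCoordBox_top M) ha.le ha' (gamD_pos a)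
    (fun k => sliceCoercive_top (lev L k) M a a' (one_le_lev' L k) ha ha')
    (fun k => by rw [JnR_top_eq]; exact injected_star_top L M a a' ha ha' k)

end Summit.QuantumFields.BalabanUV.T4Continuum.RegionInteriorW2Top

end
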